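import Summits.Ventures.YMGap.Census.OddCrossingGram
import Summits.Ventures.YMGap.Census.CharacterTwistBound
import HarnessLib

/-!
# Venture YMGap, track (b) — reflection positivity with a character weight on the crossing plaquettes of the
# ODD torus: positivity

HONEST FRAMING: venture file of the cell `pub-ymgap` (QuantumFields programme), track (b); finite-volume lattice
gauge theory only.  With the algebra of `OddCrossingGram` (the split `G(U) G(ΘU) S(U) W_×(U)` for the reflection
`θ t = 1 - t` of the odd torus, one link hyperplane and one site hyperplane; `S = √S √S` for `f ≥ 0`; every crossing
character kernel an integral Gram form) this file proves

  `crossIntegralO_nonneg`: `L` odd, `f_c ≥ 0` pointwise on `SU(2)`, `a ≥ 0` ⟹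
  `0 ≤ ∫ ∏_{p non-crossing} f_c(U_p) ∏_{p crossing} Σ_n a_{p,n} χ_n(U_p) dU`,

exactly as `CrossingWeightRP.crossIntegral_nonneg` does on the even torus: after the substitution `translateLow Y`
the integrand is `∫_{R⃗} Σ_x Γ_x Φ_{x,R⃗}(splice_C(U,Y)) Φ_{x,R⃗}(ΘU) dR⃗` with `Γ_x ≥ 0` and `Φ_{x,R⃗}` depending on the
links of `P ∪ C ∪ M` (positive, crossing, shared); all integrands are continuous on compact second-countable
spaces, one Fubini puts `R⃗` outside, and the abstract engine WITH A SHARED BLOCK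
`LatticeRP.integral_splice_mul_conj_comp_of_shared_nonneg` (conditioning on the links of the site hyperplane)
gives `≥ 0` termwise.  The pointwise positivity `f_c ≥ 0` is what "reflection positivity in planes with sites"
(Tomboulis, arXiv:0707.2179, §2 after (2.8); Fröhlich–Israel–Lieb–Simon 1978 Thm. 2.1) costs; it holds for
Tomboulis's `f = e^{A_p}/F_0` and, on the census's one-character ray, exactly for `c_{1/2} ≤ 1/4`.
Consequences (Prop. IV.1 and the marked-plaquette positivity on odd tori) are in `OddTwistBound`.

## Main statements (namespace `Summit.Ventures.YMGap.Census`)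

* `continuous_PhiO_comp`, `continuous_MintO`, `integral_comp_translateLow`, `integrand_translateLowO`.
* `rp_term_nonneg_odd`, `innerO_nonneg`, **`crossIntegralO_nonneg`**.

References: E. T. Tomboulis, arXiv:0707.2179, §2 (2.8), App. A [cite: Tomboulis2007Confinement, §2 eq. (2.8); App. A];
K. Osterwalder, E. Seiler, Ann. Phys. 110 (1978) 440, §2 [cite: OsterwalderSeilerAnnPhys1978, §2];
J. Fröhlich, R. Israel, E. H. Lieb, B. Simon, Comm. Math. Phys. 62 (1978) 1, Thm. 2.1
[cite: FrohlichIsraelLiebSimon1978, Thm. 2.1].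
-/

noncomputable section

open MeasureTheory Finset Real
open scoped BigOperators ComplexConjugate
open Literature.MathematicalPhysics.QuantumLattice
open Literature.MathematicalPhysics.QuantumFieldTheory
open Literature.MathematicalPhysics.QuantumFieldTheory.Tomboulis2007
open Literature.MathematicalPhysics.QuantumFieldTheory.WilsonRP
open Literature.MathematicalPhysics.QuantumFieldTheory.WilsonOddRP
open Summit.Ventures.LatticeQCDFlow.Exactness

namespace Summit.Ventures.YMGap.Census

variable {d L : ℕ}

section ORP

variable [NeZero d] [NeZero L] [Fact (1 < L)]

/-! #### Continuity -/

omit [Fact (1 < L)] in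
/-- `G` is continuous. -/
theorem continuous_gPosO (J : ℕ) (c : ℕ → ℝ) : Continuous (gPosO (d := d) (L := L) J c) := by
  unfold gPosO
  exact continuous_finsetProd _ fun p _ => (continuous_fR J c).comp (continuous_plaqRe p)

omit [Fact (1 < L)] in
/-- `√S` is continuous. -/
theorem continuous_sqShO (J : ℕ) (c : ℕ → ℝ) : Continuous (sqShO (d := d) (L := L) J c) := by
  unfold sqShO
  exact continuous_finsetProd _ fun p _ =>
    Real.continuous_sqrt.comp ((continuous_fR J c).comp (continuous_plaqRe p))

omit [NeZero L] [Fact (1 < L)] in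
/-- The features are continuous along continuous maps `z ↦ (F z, G z)` (composed form). -/
theorem continuous_featO_comp (p : Plaquette d L) (n : ℕ) {X : Type*} [TopologicalSpace X]
    {F : X → GaugeConfig d L SU2} {G : X → SU2} (hF : Continuous F) (hG : Continuous G) :
    Continuous fun z : X => featO p n (G z) (F z) := by
  unfold featO
  split_ifs
  · have h1 : Continuous fun W : GaugeConfig d L SU2 => halfPlaq p W := by
      unfold halfPlaq
      split_ifs <;> fun_prop
    have h2 : Continuous fun z : X => halfPlaq p (F z) * G z := (h1.comp hF).mul hG
    have h3 : Continuous fun z : X => su2a0 (halfPlaq p (F z) * G z) := continuous_su2a0.comp h2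
    exact (Polynomial.continuous (Polynomial.Chebyshev.U ℝ (n : ℤ))).comp h3
  · exact continuous_const

omit [Fact (1 < L)] in
/-- `Φ_{x,R⃗}(W)` is jointly continuous along continuous maps `z ↦ (F z, R⃗(z))`. -/
theorem continuous_PhiO_comp (J : ℕ) (c : ℕ → ℝ) (x : Plaquette d L → ℕ) {X : Type*} [TopologicalSpace X]
    {F : X → GaugeConfig d L SU2} {Rf : X → Plaquette d L → SU2} (hF : Continuous F) (hR : Continuous Rf) :
    Continuous fun z : X => PhiO J c x (Rf z) (F z) := by
  unfold PhiO
  have hG : Continuous fun z : X => gPosO J c (F z) := (continuous_gPosO J c).comp hF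
  have hS : Continuous fun z : X => sqShO J c (F z) := (continuous_sqShO J c).comp hF
  have hP : Continuous fun z : X => ∏ p, featO p (x p) (Rf z p) (F z) :=
    continuous_finsetProd _ fun p _ => continuous_featO_comp p (x p) hF ((continuous_apply p).comp hR)
  exact (hG.mul hS).mul hP

omit [Fact (1 < L)] in
/-- The tripled integrand is jointly continuous. -/
theorem continuous_MintO (J : ℕ) (c : ℕ → ℝ) (a : Plaquette d L → ℕ → ℝ) :
    Continuous (Function.uncurry (MintO (d := d) (L := L) J c a)) := by
  have h : Function.uncurry (MintO (d := d) (L := L) J c a) =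
      fun z => ∑ x ∈ Fintype.piFinset (fun _ : Plaquette d L => Finset.range (J + 1)),
        (∏ p, gWtO a p (x p)) *
          (PhiO J c x z.2 (LatticeRP.splice lowerEdges z.1) * PhiO J c x z.2 (GaugeConfig.timeReflect z.1.1)) := by
    funext z
    rfl
  rw [h]
  refine continuous_finsetSum _ fun x _ => ?_
  have h1 : Continuous fun z : (GaugeConfig d L SU2 × GaugeConfig d L SU2) × (Plaquette d L → SU2) =>
      PhiO J c x z.2 (LatticeRP.splice lowerEdges z.1) :=
    continuous_PhiO_comp J c x ((continuous_splice lowerEdges).comp continuous_fst) continuous_snd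
  have h2 : Continuous fun z : (GaugeConfig d L SU2 × GaugeConfig d L SU2) × (Plaquette d L → SU2) =>
      PhiO J c x z.2 (GaugeConfig.timeReflect z.1.1) :=
    continuous_PhiO_comp J c x (continuous_timeReflect.comp (continuous_fst.comp continuous_fst))
      continuous_snd
  exact continuous_const.mul (h1.mul h2)

omit [Fact (1 < L)] in
/-- `Φ_{x,R⃗}` is continuous in `W`. -/
theorem continuous_PhiO (J : ℕ) (c : ℕ → ℝ) (x : Plaquette d L → ℕ) (Rv : Plaquette d L → SU2) :
    Continuous (PhiO J c x Rv) :=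
  continuous_PhiO_comp J c x (F := fun W => W) (Rf := fun _ => Rv) continuous_id continuous_const

omit [Fact (1 < L)] in
/-- `z ↦ Φ_{x,R⃗(z)}(F z) Φ_{x,R⃗(z)}(G z)` is continuous along continuous `F`, `G`, `R⃗`. -/
theorem continuous_PhiO_mul (J : ℕ) (c : ℕ → ℝ) (x : Plaquette d L → ℕ) {X : Type*} [TopologicalSpace X]
    {F G : X → GaugeConfig d L SU2} {Rf : X → Plaquette d L → SU2} (hF : Continuous F) (hG : Continuous G)
    (hR : Continuous Rf) : Continuous fun z : X => PhiO J c x (Rf z) (F z) * PhiO J c x (Rf z) (G z) :=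
  (continuous_PhiO_comp J c x hF hR).mul (continuous_PhiO_comp J c x hG hR)

omit [Fact (1 < L)] in
/-- **Change of variables along `translateLow Y`** (it preserves the product Haar measure,
`WilsonOddRP.measurePreserving_translateLow`). -/
theorem integral_comp_translateLow (Y : GaugeConfig d L SU2) {H : GaugeConfig d L SU2 → ℝ} (hH : Continuous H) :
    ∫ W, H (translateLow Y W) ∂(LatticeRP.piMeasure (haarProbability SU2)) =
      ∫ W, H W ∂(LatticeRP.piMeasure (haarProbability SU2)) := by
  haveI : SecondCountableTopology SU2 := secondCountableTopology_su2
  have hT := measurePreserving_translateLow (d := d) (L := L) (G := SU2) Y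
  have h := integral_map (μ := LatticeRP.piMeasure (haarProbability SU2)) (f := H)
    hT.measurable.aemeasurable hH.aestronglyMeasurable
  rw [hT.map_eq] at h
  exact h.symm

/-! #### The pointwise identity after `translateLow Y` -/

/-- **The pointwise identity**: for `f_c ≥ 0`, after the substitution `translateLow Y` the weight configuration is
the `R⃗`-integral of the tripled integrand, `∏_p w_p(translateLow Y U) = ∫ M((U, Y), R⃗) dR⃗`. -/
theorem integrand_translateLowO (hL : Odd L) (J : ℕ) {c : ℕ → ℝ} (hf : ∀ U : SU2, 0 ≤ plaqFn J c U)
    (a : Plaquette d L → ℕ → ℝ) (W Y : GaugeConfig d L SU2) :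
    ∏ p : Plaquette d L, crossWeightO J c a p (plaqRe rhoFund (translateLow Y W) p) =
      ∫ Rv, MintO J c a (W, Y) Rv ∂(Measure.pi fun _ : Plaquette d L => haarProbability SU2) := by
  haveI : SecondCountableTopology SU2 := secondCountableTopology_su2
  have hPC : ∀ e : Edge d L, IsOPosEdge e ∨ IsOSharedEdge e → ¬ IsLowerCross e := fun e he hc => by
    rcases he with he | he
    · exact not_isOPosEdge_of_isLowerCross hc he
    · exact not_isOSharedEdge_of_isLowerCross hc he
  have hMC : ∀ e : Edge d L, IsOSharedEdge e → ¬ IsLowerCross e := fun e he => hPC e (Or.inr he)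
  have hne : ∀ e : Edge d L, IsOPosEdge e ∨ IsOSharedEdge e → ¬ IsLowerCross (edgeReflect e) := by
    intro e he hc
    have h2 := edgeReflect_of_isLowerCross (d := d) (L := L) hc
    rw [edgeReflect_edgeReflect] at h2
    rw [h2] at he
    exact hPC _ he hc
  have htr : ∀ e : Edge d L, IsOPosEdge e ∨ IsOSharedEdge e → translateLow Y W e = W e :=
    fun e he => translateLow_apply_of_not_isLowerCross Y W (hPC e he)
  have hsp : ∀ e : Edge d L, IsOPosEdge e ∨ IsOSharedEdge e →
      LatticeRP.splice lowerEdges (W, Y) e = W e :=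
    fun e he => splice_apply_of_not_isLowerCross W Y (hPC e he)
  have hΘtr : ∀ e : Edge d L, IsOPosEdge e ∨ IsOSharedEdge e →
      (translateLow Y W).timeReflect e = W.timeReflect e := by
    intro e he
    rw [timeReflect_apply, timeReflect_apply, translateLow_apply_of_not_isLowerCross Y W (hne e he)]
  have hG1 : gPosO J c (translateLow Y W) = gPosO J c (LatticeRP.splice lowerEdges (W, Y)) := by
    rw [gPosO_congr hL J c htr, ← gPosO_congr hL J c hsp]
  have hG2 : gPosO J c (translateLow Y W).timeReflect = gPosO J c W.timeReflect := gPosO_congr hL J c hΘtr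
  have hS1 : sqShO J c (translateLow Y W) = sqShO J c (LatticeRP.splice lowerEdges (W, Y)) :=
    sqShO_congr J c fun e he => by rw [htr e (Or.inr he), hsp e (Or.inr he)]
  have hS2 : sqShO J c (translateLow Y W) = sqShO J c W.timeReflect :=
    sqShO_congr J c fun e he => by
      rw [htr e (Or.inr he), timeReflect_apply_of_mem_oSharedEdges hL W e (mem_oSharedEdges.2 he)]
  have hS : gShO J c (translateLow Y W) =
      sqShO J c (LatticeRP.splice lowerEdges (W, Y)) * sqShO J c W.timeReflect := by
    rw [gShO_eq_sqShO_mul J hf, ← hS1, ← hS2]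
  rw [prod_crossWeightO_split hL J c a, wCrossO_translateLow hL J a W Y, hG1, hG2, hS, Finset.mul_sum]
  unfold MintO
  rw [integral_finsetSum _ (fun x _ =>
    (integrable_of_continuous_fin (continuous_PhiO_mul J c x (F := fun _ => LatticeRP.splice lowerEdges (W, Y))
      (G := fun _ => W.timeReflect) (Rf := fun Rv => Rv) continuous_const continuous_const
      continuous_id)).const_mul _)]
  refine Finset.sum_congr rfl fun x _ => ?_
  rw [← integral_const_mul, ← integral_const_mul]
  refine integral_congr_ae (ae_of_all _ fun Rv => ?_)
  set A := ∏ p, featO p (x p) (Rv p) (LatticeRP.splice lowerEdges (W, Y)) with hA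
  set B := ∏ p, featO p (x p) (Rv p) W.timeReflect with hB
  simp only [PhiO, ← hA, ← hB]
  ring

/-! #### Reflection positivity (with the shared block) for each auxiliary configuration -/

/-- **The RP step for one term** (odd torus): for a continuous real `Φ` depending only on the links in
`P ∪ C ∪ M`, `0 ≤ ∫∫ Φ(splice_C(U, Y)) Φ(ΘU) dμ(U) dμ(Y)`
(`LatticeRP.integral_splice_mul_conj_comp_of_shared_nonneg`; the bound from compactness). -/
theorem rp_term_nonneg_odd (hL : Odd L) {Φ : GaugeConfig d L SU2 → ℝ} (hΦc : Continuous Φ)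
    (hΦdep : DependsOn Φ
      ((oPosEdges ∪ lowerEdges ∪ oSharedEdges : Finset (Edge d L)) : Set (Edge d L))) :
    0 ≤ ∫ q, Φ (LatticeRP.splice lowerEdges q) * Φ (GaugeConfig.timeReflect q.1)
      ∂((LatticeRP.piMeasure (haarProbability SU2)).prod
        (LatticeRP.piMeasure (haarProbability SU2))) := by
  haveI : SecondCountableTopology SU2 := secondCountableTopology_su2
  obtain ⟨K, hK⟩ := isCompact_univ.exists_bound_of_continuousOn hΦc.continuousOn
  have key := LatticeRP.integral_splice_mul_conj_comp_of_shared_nonneg (haarProbability SU2) oSharedEdges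
    oPosEdges lowerEdges GaugeConfig.timeReflect measurePreserving_timeReflect
    (fun U e he => timeReflect_apply_of_mem_oSharedEdges hL U e he)
    (fun e he => dependsOn_timeReflect_apply hL e he) disjoint_oSharedEdges_oPosEdges
    disjoint_oSharedEdges_lowerEdges (Φ := fun W => ((Φ W : ℝ) : ℂ))
    (Complex.measurable_ofReal.comp hΦc.measurable) (K := K)
    (fun W => by simpa using hK W (Set.mem_univ W)) (fun A B hAB => by simp [hΦdep hAB])
  have h2 : ∫ q, ((Φ (LatticeRP.splice lowerEdges q) : ℝ) : ℂ) *
      (starRingEnd ℂ) ((Φ (GaugeConfig.timeReflect q.1) : ℝ) : ℂ)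
      ∂((LatticeRP.piMeasure (haarProbability SU2)).prod
        (LatticeRP.piMeasure (haarProbability SU2))) =
      ((∫ q, Φ (LatticeRP.splice lowerEdges q) * Φ (GaugeConfig.timeReflect q.1)
        ∂((LatticeRP.piMeasure (haarProbability SU2)).prod
          (LatticeRP.piMeasure (haarProbability SU2))) : ℝ) : ℂ) := by
    rw [← integral_complex_ofReal]
    refine integral_congr_ae (ae_of_all _ fun q => ?_)
    simp only [Complex.conj_ofReal, Complex.ofReal_mul]
  rw [h2] at key
  exact Complex.zero_le_real.1 key

/-- **Positivity of the inner double integral** for every auxiliary configuration `R⃗`, weights `a ≥ 0`. -/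
theorem innerO_nonneg (hL : Odd L) (J : ℕ) (c : ℕ → ℝ) {a : Plaquette d L → ℕ → ℝ} (ha : ∀ p n, 0 ≤ a p n)
    (Rv : Plaquette d L → SU2) :
    0 ≤ ∫ q, MintO J c a q Rv
      ∂((LatticeRP.piMeasure (haarProbability SU2)).prod (LatticeRP.piMeasure (haarProbability SU2))) := by
  haveI : SecondCountableTopology SU2 := secondCountableTopology_su2
  unfold MintO
  rw [integral_finsetSum _ (fun x _ =>
    (integrable_of_continuous_fin (continuous_PhiO_mul J c x (F := LatticeRP.splice lowerEdges)
      (G := fun q => GaugeConfig.timeReflect q.1) (Rf := fun _ => Rv) (continuous_splice lowerEdges)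
      (continuous_timeReflect.comp continuous_fst) continuous_const)).const_mul _)]
  refine Finset.sum_nonneg fun x _ => ?_
  rw [integral_const_mul]
  refine mul_nonneg (Finset.prod_nonneg fun p _ => gWtO_nonneg ha p (x p)) ?_
  exact rp_term_nonneg_odd hL (Φ := PhiO J c x Rv) (continuous_PhiO J c x Rv) (dependsOn_PhiO hL J c x Rv)

/-! ### Positivity of the crossing-weight integral on the odd torus -/

/-- **Reflection positivity in "planes with sites", with a non-negative character weight on the crossing
plaquettes**: on the ODD torus `(ℤ/Lℤ)^d`, for a plaquette function `f_c ≥ 0` pointwise on `SU(2)` and any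
`a ≥ 0`, `0 ≤ ∫ ∏_{p non-crossing} f_c(U_p) ∏_{p crossing} Σ_n a_{p,n} χ_n(U_p) dU`. -/
theorem crossIntegralO_nonneg (hL : Odd L) (J : ℕ) {c : ℕ → ℝ} (hf : ∀ U : SU2, 0 ≤ plaqFn J c U)
    {a : Plaquette d L → ℕ → ℝ} (ha : ∀ p n, 0 ≤ a p n) : 0 ≤ crossIntegralO J c a := by
  haveI : SecondCountableTopology SU2 := secondCountableTopology_su2
  have hHc : Continuous fun W : GaugeConfig d L SU2 => ∏ p, crossWeightO J c a p (plaqRe rhoFund W p) := by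
    refine continuous_finsetProd _ fun p _ => ?_
    unfold crossWeightO
    split_ifs
    · exact (continuous_charSum J (a p)).comp (continuous_plaqRe p)
    · exact (continuous_fR J c).comp (continuous_plaqRe p)
  have step1 : crossIntegralO J c a =
      ∫ Y, ∫ W, ∏ p, crossWeightO J c a p (plaqRe rhoFund (translateLow Y W) p)
        ∂(LatticeRP.piMeasure (haarProbability SU2)) ∂(LatticeRP.piMeasure (haarProbability SU2)) := by
    unfold crossIntegralO
    simp_rw [integral_comp_translateLow _ hHc, integral_const, probReal_univ, one_smul]
  have step2 : ∀ Y W : GaugeConfig d L SU2,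
      ∏ p, crossWeightO J c a p (plaqRe rhoFund (translateLow Y W) p) =
        ∫ Rv, MintO J c a (W, Y) Rv ∂(Measure.pi fun _ : Plaquette d L => haarProbability SU2) :=
    fun Y W => integrand_translateLowO hL J hf a W Y
  have hMi : Integrable (Function.uncurry (MintO J c a))
      (((LatticeRP.piMeasure (haarProbability SU2)).prod (LatticeRP.piMeasure (haarProbability SU2))).prod
        (Measure.pi fun _ : Plaquette d L => haarProbability SU2)) :=
    integrable_of_continuous_fin (continuous_MintO J c a)
  rw [step1]
  simp_rw [step2]
  rw [← integral_prod_symm (fun q => ∫ Rv, MintO J c a q Rv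
      ∂(Measure.pi fun _ : Plaquette d L => haarProbability SU2)) hMi.integral_prod_left,
    integral_integral_swap hMi]
  exact integral_nonneg fun Rv => innerO_nonneg hL J c ha Rv

end ORP

end Summit.Ventures.YMGap.Census

end
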